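import Summits.HubbardSuperconductivity.HubbardSuperconductivity.Theses.FunctionFieldCertificate
import Summits.HubbardSuperconductivity.HubbardSuperconductivity.Theorems.FunctionFieldCertificateMesoscopicPairOrderScaleMonotone
import HarnessLib

/-!
# Crux `MesoscopicPairOrder` (stmt-HubbardSuperconductivity-7331), line `redirect_birth`, stub (Q)
# `stub_pairFluctuationFloor`: the fixed-scale floor family is determined by its TAIL

Helper for stub (Q) (wave 2 of lead c10; the stub itself is OPEN and is NOT proved or refuted here).
(Q) asks, at every point of the box `U ∈ (0,6]`, `δ ∈ [1/10,3/10]` and EVERY block scale `R ≥ 1`, a floor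
`c(U,δ,R) ≤ T_R(ψ)/L²` on the Fejér-box `d`-wave pair functional `T_R(ψ) = Σ_{x,y} Πᵢ (1 - |(y - x)ᵢ|_L/R)₊
Re⟨P_x ψ, P_y ψ⟩`, `P_x = localPair dWaveFormFactor L x`, of every normalised `(N_L, S^z = 0)`-sector ground
state of `hubbardTorus 2 L 1 U`, eventually in even `L` (the composition `meso_and_summit_of_boxStubs`
consumes it at ONE scale `max R₁ 1` at (D)'s witness, `superlinearAt_of_floorAt_of_doublingAt`). This file
is the model-free bookkeeping of the family `R ↦ (Q)-body at (U, δ, R)` along divisibility of scales: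

* `fluctuationFloorAt_of_mul` — FLOORS PROPAGATE DOWN: the (Q)-body at `(U, δ)` and scale `k R` (`k ≥ 1`)
  with constant `c` implies the (Q)-body at scale `R` with constant `c/k²`, eventually in even `L`
  (`T_{kR} ≤ k² T_R`, `boxSum_mul_le_sq_mul_boxSum`; side condition `2kR ≤ L` absorbed into `L₀`);
  `fluctuationFloorAt_exists_of_mul` — the same for `∃ c > 0` (hence along divisibility `R ∣ R'`);
* `not_fluctuationFloorAt_mul` — FAILURES PROPAGATE UP: no floor at scale `R` ⇒ no floor at any `k R`;
* `fluctuationFloorAt_forall_iff_forall_mem` — at a point, the full family `∀ R > 0` is EQUIVALENT to its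
  restriction to any multiplicatively cofinal set of scales `𝒮` (every `R ≥ 1` has a multiple in `𝒮`:
  `{R ≥ R₀}`, the multiples of `R₀`, the factorials; NOT the dyadic scales `2^j`, which contain no
  multiple of `3`); `fluctuationFloorAt_forall_iff_forall_ge` — the instance `𝒮 = {R ≥ R₀}`;
* `pairFluctuationFloor_iff_forall_ge`, `pairFluctuationFloor_iff_eventually` — consequently the
  REGISTERED statement of (Q) (verbatim, left) is equivalent to its tail `∀ R ≥ R₀` for any fixed
  `R₀ ≥ 1`, and to its pointwise-eventual form `∀ (U,δ) ∃ R₀ ∀ R ≥ R₀` (right).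

NOT available: an upward transfer of floors — the only model-free inequality in that direction is the
CEILING `T_{2R} ≤ 4 T_R` (`boxSum_mul_le_sq_mul_boxSum`, `k = 2`), so a floor at scale `R` (e.g. the local
pair weight floor `R = 1`, the weakest instance, `localWeight_ge_of_fluctuationFloorAt`) implies nothing
at `2R`: the family is not generated by its head. Prover: (Q) says "at every point of the box the
small-momentum `d`-wave pair fluctuations have a floor at all SUFFICIENTLY LARGE block scales"; refuter:
killing the floor at ONE scale at one point kills it at every multiple there, hence kills (Q).
Sources: Stein–Shakarchi, *Fourier Analysis* (2003), Ch. 2–3 (`F_{kR} = F_k(R·) F_R ≤ k² F_R`);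
Kennedy–Lieb–Shastry, PRL 61 (1988) 2582. Folklore bookkeeping over the landed scale ladder; no
definition, no named fact, no sorry; nothing here claims the stub, a piece or the crux.
-/

noncomputable section

-- the summit namespace repeats the problem name by design (D-0017)
set_option linter.dupNamespace false

namespace Summit.HubbardSuperconductivity.HubbardSuperconductivity.Theorems.FunctionFieldCertificate

open Matrix Finset Filter
open Literature.Probability.LatticeModels Literature.MathematicalPhysics.QuantumLattice
open Summit.HubbardSuperconductivity.HubbardSuperconductivity.Theses.FunctionFieldCertificate
open scoped ComplexOrder ComplexConjugate

/-! ### Floors propagate down the divisibility order of the scales -/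

/-- **Floors propagate DOWN along multiples** (constant explicit). If the body of (Q) holds at `(U, δ)`
at the scale `k R` (`R, k ≥ 1`) with constant `c`, then it holds at the scale `R` with constant `c/k²`:
for `L ≥ max L₀ (2kR)` even and every normalised sector ground state,
`c L² ≤ T_{kR}(ψ) ≤ k² T_R(ψ)` (`boxSum_mul_le_sq_mul_boxSum`). Stein–Shakarchi, Ch. 2–3. [folklore] -/
theorem fluctuationFloorAt_of_mul {U δ c : ℝ} {R k : ℕ} (hR : 0 < R) (hk : 0 < k)
    (h : ∃ L₀ : ℕ, ∀ (L : ℕ) [NeZero L], L₀ ≤ L → Even L →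
        ∀ ψ : Fock (Orb (FermionTorus 2 L)), star ψ ⬝ᵥ ψ = 1 →
          IsGroundStateInSector (hubbardTorus 2 L 1 U) (2 * ⌊(1 - δ) * (L : ℝ) ^ 2 / 2⌋₊) 0 ψ →
            c ≤ (∑ x : TorusSite 2 L, ∑ y : TorusSite 2 L,
                  (∏ i : Fin 2, max 0 (1 - |(((y i - x i).valMinAbs : ℤ) : ℝ)| / ((k * R : ℕ) : ℝ))) *
                    (star (localPair dWaveFormFactor L x *ᵥ ψ) ⬝ᵥ (localPair dWaveFormFactor L y *ᵥ ψ)).re) /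
                (L : ℝ) ^ 2) :
    ∃ L₀ : ℕ, ∀ (L : ℕ) [NeZero L], L₀ ≤ L → Even L →
      ∀ ψ : Fock (Orb (FermionTorus 2 L)), star ψ ⬝ᵥ ψ = 1 →
        IsGroundStateInSector (hubbardTorus 2 L 1 U) (2 * ⌊(1 - δ) * (L : ℝ) ^ 2 / 2⌋₊) 0 ψ →
          c / (k : ℝ) ^ 2 ≤ (∑ x : TorusSite 2 L, ∑ y : TorusSite 2 L,
                (∏ i : Fin 2, max 0 (1 - |(((y i - x i).valMinAbs : ℤ) : ℝ)| / (R : ℝ))) *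
                  (star (localPair dWaveFormFactor L x *ᵥ ψ) ⬝ᵥ (localPair dWaveFormFactor L y *ᵥ ψ)).re) /
              (L : ℝ) ^ 2 := by
  obtain ⟨L₀, hL⟩ := h
  refine ⟨max L₀ (2 * (k * R)), fun L _ hLge hEven ψ hψ hgs => ?_⟩
  have hL0 : L₀ ≤ L := le_of_max_le_left hLge
  have hkRL : 2 * (k * R) ≤ L := le_of_max_le_right hLge
  have hbody := hL L hL0 hEven ψ hψ hgs
  have hmono := boxSum_mul_le_sq_mul_boxSum' R k hR hk hkRL ψ
  have hLpos : (0 : ℝ) < L := Nat.cast_pos.2 (Nat.pos_of_ne_zero (NeZero.ne L))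
  have hL2 : (0 : ℝ) < (L : ℝ) ^ 2 := by positivity
  have hkpos : (0 : ℝ) < k := Nat.cast_pos.2 hk
  have hk2 : (0 : ℝ) < (k : ℝ) ^ 2 := by positivity
  rw [div_le_iff₀ hk2]
  exact (hbody.trans (div_le_div_of_nonneg_right hmono hL2.le)).trans_eq (by ring)

/-- **Floors propagate DOWN along multiples** (`∃ c > 0` form): the body of (Q) at `(U, δ)` at the scale
`k R` (`R, k ≥ 1`) implies the body of (Q) at the scale `R` (constant `c ↦ c/k²`). [folklore] -/
theorem fluctuationFloorAt_exists_of_mul {U δ : ℝ} {R k : ℕ} (hR : 0 < R) (hk : 0 < k)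
    (h : ∃ c : ℝ, 0 < c ∧ ∃ L₀ : ℕ, ∀ (L : ℕ) [NeZero L], L₀ ≤ L → Even L →
        ∀ ψ : Fock (Orb (FermionTorus 2 L)), star ψ ⬝ᵥ ψ = 1 →
          IsGroundStateInSector (hubbardTorus 2 L 1 U) (2 * ⌊(1 - δ) * (L : ℝ) ^ 2 / 2⌋₊) 0 ψ →
            c ≤ (∑ x : TorusSite 2 L, ∑ y : TorusSite 2 L,
                  (∏ i : Fin 2, max 0 (1 - |(((y i - x i).valMinAbs : ℤ) : ℝ)| / ((k * R : ℕ) : ℝ))) *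
                    (star (localPair dWaveFormFactor L x *ᵥ ψ) ⬝ᵥ (localPair dWaveFormFactor L y *ᵥ ψ)).re) /
                (L : ℝ) ^ 2) :
    ∃ c : ℝ, 0 < c ∧ ∃ L₀ : ℕ, ∀ (L : ℕ) [NeZero L], L₀ ≤ L → Even L →
      ∀ ψ : Fock (Orb (FermionTorus 2 L)), star ψ ⬝ᵥ ψ = 1 →
        IsGroundStateInSector (hubbardTorus 2 L 1 U) (2 * ⌊(1 - δ) * (L : ℝ) ^ 2 / 2⌋₊) 0 ψ →
          c ≤ (∑ x : TorusSite 2 L, ∑ y : TorusSite 2 L,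
                (∏ i : Fin 2, max 0 (1 - |(((y i - x i).valMinAbs : ℤ) : ℝ)| / (R : ℝ))) *
                  (star (localPair dWaveFormFactor L x *ᵥ ψ) ⬝ᵥ (localPair dWaveFormFactor L y *ᵥ ψ)).re) /
              (L : ℝ) ^ 2 := by
  obtain ⟨c, hc, hbody⟩ := h
  have hkpos : (0 : ℝ) < k := Nat.cast_pos.2 hk
  exact ⟨c / (k : ℝ) ^ 2, by positivity, fluctuationFloorAt_of_mul hR hk hbody⟩

/-- **Failures propagate UP along multiples** (the refuter's reading): if the body of (Q) fails at
`(U, δ)` at the scale `R ≥ 1` (no constant `c > 0` works), it fails at every multiple `k R`, `k ≥ 1`.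
The converse transfer is not available: between `T_R` and `T_{kR}` the only model-free inequality is
the ceiling `T_{kR} ≤ k² T_R` (`boxSum_mul_le_sq_mul_boxSum`), which is why the family `R ↦ (Q)-body`
is not generated by its head `R = 1` (the local pair weight floor). [folklore] -/
theorem not_fluctuationFloorAt_mul {U δ : ℝ} {R k : ℕ} (hR : 0 < R) (hk : 0 < k)
    (h : ¬ ∃ c : ℝ, 0 < c ∧ ∃ L₀ : ℕ, ∀ (L : ℕ) [NeZero L], L₀ ≤ L → Even L →
        ∀ ψ : Fock (Orb (FermionTorus 2 L)), star ψ ⬝ᵥ ψ = 1 →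
          IsGroundStateInSector (hubbardTorus 2 L 1 U) (2 * ⌊(1 - δ) * (L : ℝ) ^ 2 / 2⌋₊) 0 ψ →
            c ≤ (∑ x : TorusSite 2 L, ∑ y : TorusSite 2 L,
                  (∏ i : Fin 2, max 0 (1 - |(((y i - x i).valMinAbs : ℤ) : ℝ)| / (R : ℝ))) *
                    (star (localPair dWaveFormFactor L x *ᵥ ψ) ⬝ᵥ (localPair dWaveFormFactor L y *ᵥ ψ)).re) /
                (L : ℝ) ^ 2) :
    ¬ ∃ c : ℝ, 0 < c ∧ ∃ L₀ : ℕ, ∀ (L : ℕ) [NeZero L], L₀ ≤ L → Even L →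
        ∀ ψ : Fock (Orb (FermionTorus 2 L)), star ψ ⬝ᵥ ψ = 1 →
          IsGroundStateInSector (hubbardTorus 2 L 1 U) (2 * ⌊(1 - δ) * (L : ℝ) ^ 2 / 2⌋₊) 0 ψ →
            c ≤ (∑ x : TorusSite 2 L, ∑ y : TorusSite 2 L,
                  (∏ i : Fin 2, max 0 (1 - |(((y i - x i).valMinAbs : ℤ) : ℝ)| / ((k * R : ℕ) : ℝ))) *
                    (star (localPair dWaveFormFactor L x *ᵥ ψ) ⬝ᵥ (localPair dWaveFormFactor L y *ᵥ ψ)).re) /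
                (L : ℝ) ^ 2 :=
  fun h' => h (fluctuationFloorAt_exists_of_mul hR hk h')

/-- **Multiplicatively cofinal sets of scales suffice, at a point.** If every scale `R ≥ 1` has a
multiple `k R` (`k ≥ 1`) in `𝒮 ⊆ ℕ` (`{R ≥ R₀}`, the multiples of `R₀`, the factorials), then at `(U, δ)`
the full family "`∀ R > 0`, the body of (Q) at scale `R`" is equivalent to its restriction to `𝒮`.
[folklore] -/
theorem fluctuationFloorAt_forall_iff_forall_mem {U δ : ℝ} {𝒮 : Set ℕ}
    (h𝒮 : ∀ R : ℕ, 0 < R → ∃ k : ℕ, 0 < k ∧ k * R ∈ 𝒮) :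
    (∀ R : ℕ, 0 < R → ∃ c : ℝ, 0 < c ∧ ∃ L₀ : ℕ, ∀ (L : ℕ) [NeZero L], L₀ ≤ L → Even L →
        ∀ ψ : Fock (Orb (FermionTorus 2 L)), star ψ ⬝ᵥ ψ = 1 →
          IsGroundStateInSector (hubbardTorus 2 L 1 U) (2 * ⌊(1 - δ) * (L : ℝ) ^ 2 / 2⌋₊) 0 ψ →
            c ≤ (∑ x : TorusSite 2 L, ∑ y : TorusSite 2 L,
              (∏ i : Fin 2, max 0 (1 - |(((y i - x i).valMinAbs : ℤ) : ℝ)| / (R : ℝ))) *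
                (star (localPair dWaveFormFactor L x *ᵥ ψ) ⬝ᵥ (localPair dWaveFormFactor L y *ᵥ ψ)).re) /
              (L : ℝ) ^ 2) ↔
    (∀ R ∈ 𝒮, 0 < R → ∃ c : ℝ, 0 < c ∧ ∃ L₀ : ℕ, ∀ (L : ℕ) [NeZero L], L₀ ≤ L → Even L →
        ∀ ψ : Fock (Orb (FermionTorus 2 L)), star ψ ⬝ᵥ ψ = 1 →
          IsGroundStateInSector (hubbardTorus 2 L 1 U) (2 * ⌊(1 - δ) * (L : ℝ) ^ 2 / 2⌋₊) 0 ψ →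
            c ≤ (∑ x : TorusSite 2 L, ∑ y : TorusSite 2 L,
              (∏ i : Fin 2, max 0 (1 - |(((y i - x i).valMinAbs : ℤ) : ℝ)| / (R : ℝ))) *
                (star (localPair dWaveFormFactor L x *ᵥ ψ) ⬝ᵥ (localPair dWaveFormFactor L y *ᵥ ψ)).re) /
              (L : ℝ) ^ 2) := by
  refine ⟨fun h R _ hR => h R hR, fun h R hR => ?_⟩
  obtain ⟨k, hk, hmem⟩ := h𝒮 R hR
  exact fluctuationFloorAt_exists_of_mul hR hk (h (k * R) hmem (Nat.mul_pos hk hR))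

/-- **The tail `R ≥ R₀` suffices, at a point**: for any fixed `R₀ ≥ 1`, at `(U, δ)` the full family
"`∀ R > 0`, the body of (Q) at scale `R`" is equivalent to its tail `∀ R ≥ R₀` (the scale `R₀ R` is a
multiple of `R` in the tail; `fluctuationFloorAt_exists_of_mul` with `k = R₀`). [folklore] -/
theorem fluctuationFloorAt_forall_iff_forall_ge {U δ : ℝ} {R₀ : ℕ} (hR₀ : 0 < R₀) :
    (∀ R : ℕ, 0 < R → ∃ c : ℝ, 0 < c ∧ ∃ L₀ : ℕ, ∀ (L : ℕ) [NeZero L], L₀ ≤ L → Even L →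
        ∀ ψ : Fock (Orb (FermionTorus 2 L)), star ψ ⬝ᵥ ψ = 1 →
          IsGroundStateInSector (hubbardTorus 2 L 1 U) (2 * ⌊(1 - δ) * (L : ℝ) ^ 2 / 2⌋₊) 0 ψ →
            c ≤ (∑ x : TorusSite 2 L, ∑ y : TorusSite 2 L,
              (∏ i : Fin 2, max 0 (1 - |(((y i - x i).valMinAbs : ℤ) : ℝ)| / (R : ℝ))) *
                (star (localPair dWaveFormFactor L x *ᵥ ψ) ⬝ᵥ (localPair dWaveFormFactor L y *ᵥ ψ)).re) /
              (L : ℝ) ^ 2) ↔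
    (∀ R : ℕ, R₀ ≤ R → ∃ c : ℝ, 0 < c ∧ ∃ L₀ : ℕ, ∀ (L : ℕ) [NeZero L], L₀ ≤ L → Even L →
        ∀ ψ : Fock (Orb (FermionTorus 2 L)), star ψ ⬝ᵥ ψ = 1 →
          IsGroundStateInSector (hubbardTorus 2 L 1 U) (2 * ⌊(1 - δ) * (L : ℝ) ^ 2 / 2⌋₊) 0 ψ →
            c ≤ (∑ x : TorusSite 2 L, ∑ y : TorusSite 2 L,
              (∏ i : Fin 2, max 0 (1 - |(((y i - x i).valMinAbs : ℤ) : ℝ)| / (R : ℝ))) *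
                (star (localPair dWaveFormFactor L x *ᵥ ψ) ⬝ᵥ (localPair dWaveFormFactor L y *ᵥ ψ)).re) /
              (L : ℝ) ^ 2) :=
  ⟨fun h R hR => h R (hR₀.trans_le hR),
    fun h R hR => fluctuationFloorAt_exists_of_mul hR hR₀ (h (R₀ * R) (Nat.le_mul_of_pos_right R₀ hR))⟩

/-- **(Q) ⟺ its tail `R ≥ R₀`.** For any fixed `R₀ ≥ 1`, the registered statement of stub (Q)
(`stub_pairFluctuationFloor`, verbatim, left) is equivalent to the same statement with `∀ R > 0`
replaced by `∀ R ≥ R₀` (right): the head `R < R₀` of the family is recovered from the scales `R₀ R` of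
the tail (`fluctuationFloorAt_forall_iff_forall_ge`). [folklore] -/
theorem pairFluctuationFloor_iff_forall_ge {R₀ : ℕ} (hR₀ : 0 < R₀) :
    (∀ U : ℝ, U ∈ Set.Ioc (0:ℝ) 6 → ∀ δ : ℝ, δ ∈ Set.Icc (1 / 10 : ℝ) (3 / 10) → ∀ R : ℕ, 0 < R →
      ∃ c : ℝ, 0 < c ∧ ∃ L₀ : ℕ, ∀ (L : ℕ) [NeZero L], L₀ ≤ L → Even L →
        ∀ ψ : Fock (Orb (FermionTorus 2 L)), star ψ ⬝ᵥ ψ = 1 →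
          IsGroundStateInSector (hubbardTorus 2 L 1 U) (2 * ⌊(1 - δ) * (L : ℝ) ^ 2 / 2⌋₊) 0 ψ →
            c ≤ (∑ x : TorusSite 2 L, ∑ y : TorusSite 2 L,
              (∏ i : Fin 2, max 0 (1 - |(((y i - x i).valMinAbs : ℤ) : ℝ)| / (R : ℝ))) *
                (star (localPair dWaveFormFactor L x *ᵥ ψ) ⬝ᵥ (localPair dWaveFormFactor L y *ᵥ ψ)).re) /
              (L : ℝ) ^ 2) ↔
    (∀ U : ℝ, U ∈ Set.Ioc (0:ℝ) 6 → ∀ δ : ℝ, δ ∈ Set.Icc (1 / 10 : ℝ) (3 / 10) → ∀ R : ℕ, R₀ ≤ R →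
      ∃ c : ℝ, 0 < c ∧ ∃ L₀ : ℕ, ∀ (L : ℕ) [NeZero L], L₀ ≤ L → Even L →
        ∀ ψ : Fock (Orb (FermionTorus 2 L)), star ψ ⬝ᵥ ψ = 1 →
          IsGroundStateInSector (hubbardTorus 2 L 1 U) (2 * ⌊(1 - δ) * (L : ℝ) ^ 2 / 2⌋₊) 0 ψ →
            c ≤ (∑ x : TorusSite 2 L, ∑ y : TorusSite 2 L,
              (∏ i : Fin 2, max 0 (1 - |(((y i - x i).valMinAbs : ℤ) : ℝ)| / (R : ℝ))) *
                (star (localPair dWaveFormFactor L x *ᵥ ψ) ⬝ᵥ (localPair dWaveFormFactor L y *ᵥ ψ)).re) /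
              (L : ℝ) ^ 2) :=
  ⟨fun h U hU δ hδ => (fluctuationFloorAt_forall_iff_forall_ge hR₀).1 (h U hU δ hδ),
    fun h U hU δ hδ => (fluctuationFloorAt_forall_iff_forall_ge hR₀).2 (h U hU δ hδ)⟩

/-- **(Q) ⟺ its pointwise-eventual form.** The registered statement of stub (Q)
(`stub_pairFluctuationFloor`, verbatim, left) is equivalent to: at every point of the box `U ∈ (0,6]`,
`δ ∈ [1/10,3/10]` there is `R₀` (depending on the point) such that the body of (Q) holds at every scale
`R ≥ R₀` (right) — a floor at all SUFFICIENTLY LARGE block scales; nothing is gained or lost by the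
choice of scales (`k = R₀ + 1` in `fluctuationFloorAt_forall_iff_forall_ge`). [folklore] -/
theorem pairFluctuationFloor_iff_eventually :
    (∀ U : ℝ, U ∈ Set.Ioc (0:ℝ) 6 → ∀ δ : ℝ, δ ∈ Set.Icc (1 / 10 : ℝ) (3 / 10) → ∀ R : ℕ, 0 < R →
      ∃ c : ℝ, 0 < c ∧ ∃ L₀ : ℕ, ∀ (L : ℕ) [NeZero L], L₀ ≤ L → Even L →
        ∀ ψ : Fock (Orb (FermionTorus 2 L)), star ψ ⬝ᵥ ψ = 1 →
          IsGroundStateInSector (hubbardTorus 2 L 1 U) (2 * ⌊(1 - δ) * (L : ℝ) ^ 2 / 2⌋₊) 0 ψ →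
            c ≤ (∑ x : TorusSite 2 L, ∑ y : TorusSite 2 L,
              (∏ i : Fin 2, max 0 (1 - |(((y i - x i).valMinAbs : ℤ) : ℝ)| / (R : ℝ))) *
                (star (localPair dWaveFormFactor L x *ᵥ ψ) ⬝ᵥ (localPair dWaveFormFactor L y *ᵥ ψ)).re) /
              (L : ℝ) ^ 2) ↔
    (∀ U : ℝ, U ∈ Set.Ioc (0:ℝ) 6 → ∀ δ : ℝ, δ ∈ Set.Icc (1 / 10 : ℝ) (3 / 10) → ∃ R₀ : ℕ, ∀ R : ℕ, R₀ ≤ R →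
      ∃ c : ℝ, 0 < c ∧ ∃ L₀ : ℕ, ∀ (L : ℕ) [NeZero L], L₀ ≤ L → Even L →
        ∀ ψ : Fock (Orb (FermionTorus 2 L)), star ψ ⬝ᵥ ψ = 1 →
          IsGroundStateInSector (hubbardTorus 2 L 1 U) (2 * ⌊(1 - δ) * (L : ℝ) ^ 2 / 2⌋₊) 0 ψ →
            c ≤ (∑ x : TorusSite 2 L, ∑ y : TorusSite 2 L,
              (∏ i : Fin 2, max 0 (1 - |(((y i - x i).valMinAbs : ℤ) : ℝ)| / (R : ℝ))) *
                (star (localPair dWaveFormFactor L x *ᵥ ψ) ⬝ᵥ (localPair dWaveFormFactor L y *ᵥ ψ)).re) /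
              (L : ℝ) ^ 2) := by
  refine ⟨fun h U hU δ hδ => ⟨1, (fluctuationFloorAt_forall_iff_forall_ge Nat.one_pos).1 (h U hU δ hδ)⟩,
    fun h U hU δ hδ => ?_⟩
  obtain ⟨R₀, hR₀⟩ := h U hU δ hδ
  exact (fluctuationFloorAt_forall_iff_forall_ge (Nat.succ_pos R₀)).2
    fun R hR => hR₀ R ((Nat.le_succ R₀).trans hR)

/-- Registered sub-goal form (line `redirect_birth`, lead c10, wave 2): the registered statement of (Q), verbatim,
is equivalent to its pointwise-eventual tail `∀ (U,δ) ∃ R₀ ∀ R ≥ R₀` (`pairFluctuationFloor_iff_eventually`). [folklore] -/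
theorem pairFluctuationFloorIffEventually : (∀ U : ℝ, U ∈ Set.Ioc (0:ℝ) 6 → ∀ δ : ℝ, δ ∈ Set.Icc (1 / 10 : ℝ) (3 / 10) → ∀ R : ℕ, 0 < R → ∃ c : ℝ, 0 < c ∧ ∃ L₀ : ℕ, ∀ (L : ℕ) [NeZero L], L₀ ≤ L → Even L → ∀ ψ : Fock (Orb (FermionTorus 2 L)), star ψ ⬝ᵥ ψ = 1 → IsGroundStateInSector (hubbardTorus 2 L 1 U) (2 * ⌊(1 - δ) * (L : ℝ) ^ 2 / 2⌋₊) 0 ψ → c ≤ (∑ x : TorusSite 2 L, ∑ y : TorusSite 2 L, (∏ i : Fin 2, max 0 (1 - |(((y i - x i).valMinAbs : ℤ) : ℝ)| / (R : ℝ))) * (star (localPair dWaveFormFactor L x *ᵥ ψ) ⬝ᵥ (localPair dWaveFormFactor L y *ᵥ ψ)).re) / (L : ℝ) ^ 2) ↔ (∀ U : ℝ, U ∈ Set.Ioc (0:ℝ) 6 → ∀ δ : ℝ, δ ∈ Set.Icc (1 / 10 : ℝ) (3 / 10) → ∃ R₀ : ℕ, ∀ R : ℕ, R₀ ≤ R →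 ∃ c : ℝ, 0 < c ∧ ∃ L₀ : ℕ, ∀ (L : ℕ) [NeZero L], L₀ ≤ L → Even L → ∀ ψ : Fock (Orb (FermionTorus 2 L)), star ψ ⬝ᵥ ψ = 1 → IsGroundStateInSector (hubbardTorus 2 L 1 U) (2 * ⌊(1 - δ) * (L : ℝ) ^ 2 / 2⌋₊) 0 ψ → c ≤ (∑ x : TorusSite 2 L, ∑ y : TorusSite 2 L, (∏ i : Fin 2, max 0 (1 - |(((y i - x i).valMinAbs : ℤ) : ℝ)| / (R : ℝ))) * (star (localPair dWaveFormFactor L x *ᵥ ψ) ⬝ᵥ (localPair dWaveFormFactor L y *ᵥ ψ)).re) / (L : ℝ) ^ 2) :=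
  pairFluctuationFloor_iff_eventually

end Summit.HubbardSuperconductivity.HubbardSuperconductivity.Theorems.FunctionFieldCertificate
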